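import Summits.Schanuel.Schanuel.Theorems.SoloInformedAdditiveRigidity
import Summits.Schanuel.Schanuel.Theorems.SoloInformedAdditiveValueRigidity

/-!
# Few violated additive coincidences force an affine law (Theorem C)

The "99 %" rigidity statement behind the additive-energy line of the Roy-type additive
small-value nodes (`SoloInformedRoyAdditiveDirichlet`).  Let `S ⊆ [1, K]` miss at most `K / 100`
points of `[1, K]` and let `φ : ℕ → G` take values in an additive commutative group.  A
*violated additive coincidence* is a triple `(a, b, u)` with `a, a + u, b, b + u ∈ S` and
`φ (a + u) - φ a ≠ φ (b + u) - φ b` (two pairs with the same difference `u` but different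
increments).  If a finite set `V` contains all of them and `10⁴ · #V ≤ K³`, then `φ` is affine,
`φ s = γ + s • μ`, at every `s ∈ S` outside a set `X` with `K² · #X ≤ 110 · #V`.  (When `φ s` is
the root `ρ_s` of an integer polynomial served at the point `s ξ + η` of an arithmetic
progression, `#V / 2` is the number `N'` of violated coincidences among the served roots, which
the additive-energy inequality bounds by `O(D³ h / log (1/ε))`; the theorem then produces the
affine family of roots that feeds Gel'fond's criterion.)

Proof outline (constants convenient, not optimal; `Q = K / 4`, `E = [1, K] \ S`).
* For a difference `u ≤ Q` let `P u = {a ∈ S | a + u ∈ S}` (`#(P u) ≥ K - Q - 2 #E ≥ 0.73 K`)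
  and pick `a₀ u ∈ P u` whose increment `δ u = φ (a₀ u + u) - φ (a₀ u)` disagrees with the
  fewest members of `P u`; let `B u ⊆ P u` be those members.  Every `a ∈ P u` disagrees with at
  least `#(B u)` members, so `∑_{u ≤ Q} #(P u) · #(B u) ≤ #V` (fibrewise count of `V`).
* Hence the set `NG` of `u ≤ Q` with `20 · #(B u) > K` has `365 · #NG ≤ K`, and
  `W = ∑_{u good} #(B u)` has `7300 · W ≤ K²`.
* Good differences add: for good `u, v, u + v` a base point `s` with the three pairs
  `(s, s + u)`, `(s + u, s + u + v)`, `(s, s + u + v)` in `S` and outside `B` exists by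
  pigeonhole, giving `δ (u + v) = δ u + δ v`; Lemma L
  (`soloAR_additive_on_dense_interval_eq_nsmul`, on `[1, Q]`) gives `δ u = u • μ` for good `u`.
* Then `c s = φ s - s • μ` satisfies `c (a + u) = c a` for every good `u` and `a ∈ P u \ B u`,
  and Lemma T (`soloAV_eq_const_off_sparse`) makes `c` constant off a set `X` with
  `#X · (K / 40 + 1) ≤ 2 W`; finally `73 K² · #X ≤ 8000 · #V`.
No novelty is claimed for the combinatorics.
-/

namespace Summit.Schanuel.Schanuel.Theorems

/-- **Theorem C (few violated additive coincidences force an affine law).**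
Let `G` be an additive commutative group, `K ≥ 1000`, `S ⊆ [1, K]` with
`100 · #([1, K] \ S) ≤ K`, `φ : ℕ → G`, and let `V` be a finite set of triples containing every
`((a, b), u)` with `a, b, a + u, b + u ∈ S` and `φ (a + u) - φ a ≠ φ (b + u) - φ b`.
If `10000 · #V ≤ K ^ 3`, then there are `γ μ : G` and a finite set `X` with
`K ^ 2 · #X ≤ 110 · #V` such that `φ s = γ + s • μ` for every `s ∈ S` outside `X`. -/
theorem soloAC_affine_off_sparse_of_few_violations {G : Type*} [AddCommGroup G] {K : ℕ}
    (hK : 1000 ≤ K) {S : Finset ℕ} (hS : S ⊆ Finset.Icc 1 K)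
    (hE : 100 * (Finset.Icc 1 K \ S).card ≤ K) (φ : ℕ → G) {V : Finset ((ℕ × ℕ) × ℕ)}
    (hV : ∀ a ∈ S, ∀ b ∈ S, ∀ u : ℕ, a + u ∈ S → b + u ∈ S →
      φ (a + u) - φ a ≠ φ (b + u) - φ b → ((a, b), u) ∈ V)
    (hVK : 10000 * V.card ≤ K ^ 3) :
    ∃ γ μ : G, ∃ X : Finset ℕ, K ^ 2 * X.card ≤ 110 * V.card ∧
      ∀ s ∈ S, s ∉ X → φ s = γ + s • μ := by
  classical
  -- the exceptional set `E` and the scale `Q = K / 4`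
  obtain ⟨E, hEdef⟩ : ∃ E : Finset ℕ, E = Finset.Icc 1 K \ S := ⟨_, rfl⟩
  have hEc : 100 * E.card ≤ K := by rw [hEdef]; exact hE
  obtain ⟨Q, hQ⟩ : ∃ Q : ℕ, Q = K / 4 := ⟨_, rfl⟩
  have memS : ∀ x, 1 ≤ x → x ≤ K → x ∉ E → x ∈ S := by
    intro x h1 h2 h3
    by_contra h4
    exact h3 (by rw [hEdef]; exact Finset.mem_sdiff.mpr ⟨Finset.mem_Icc.mpr ⟨h1, h2⟩, h4⟩)
  -- pairs with difference `u` (by lower endpoint) and disagreement sets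
  obtain ⟨P, hP⟩ : ∃ P : ℕ → Finset ℕ, ∀ u, P u = S.filter (fun a => a + u ∈ S) :=
    ⟨_, fun _ => rfl⟩
  obtain ⟨D, hD⟩ : ∃ D : ℕ → ℕ → Finset ℕ,
      ∀ u a, D u a = (P u).filter (fun b => φ (a + u) - φ a ≠ φ (b + u) - φ b) :=
    ⟨_, fun _ _ => rfl⟩
  have memP : ∀ u a, a ∈ P u → a ∈ S ∧ a + u ∈ S := by
    intro u a ha
    rw [hP] at ha
    exact Finset.mem_filter.mp ha
  -- `#(P u) ≥ K - Q - 2 #E` for `u ≤ Q`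
  have hPcard : ∀ u, u ≤ Q → K - Q ≤ (P u).card + (E.card + E.card) := by
    intro u hu
    have hsub : Finset.Icc 1 (K - Q) ⊆ P u ∪ (E ∪ E.image (fun x => x - u)) := by
      intro a ha
      rw [Finset.mem_Icc] at ha
      rw [Finset.mem_union, Finset.mem_union]
      by_cases h1 : a ∈ E
      · exact Or.inr (Or.inl h1)
      by_cases h2 : a + u ∈ E
      · exact Or.inr (Or.inr (Finset.mem_image.mpr ⟨a + u, h2, Nat.add_sub_cancel a u⟩))
      · left
        rw [hP]
        exact Finset.mem_filter.mpr
          ⟨memS a (by omega) (by omega) h1, memS (a + u) (by omega) (by omega) h2⟩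
    have h := (Finset.card_le_card hsub).trans (Finset.card_union_le _ _)
    have h' := Finset.card_union_le E (E.image (fun x => x - u))
    have h'' : (E.image (fun x => x - u)).card ≤ E.card := Finset.card_image_le
    rw [Nat.card_Icc] at h
    omega
  have hP73 : ∀ u, u ≤ Q → 73 * K ≤ 100 * (P u).card := by
    intro u hu
    have := hPcard u hu
    omega
  -- a representative `a₀ u ∈ P u` disagreeing with the fewest members of `P u`
  have hrep : ∀ u, ∃ a, (1 ≤ u → u ≤ Q →
      (a ∈ P u ∧ ∀ b ∈ P u, (D u a).card ≤ (D u b).card)) := by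
    intro u
    by_cases hu : 1 ≤ u ∧ u ≤ Q
    · have hne : (P u).Nonempty := Finset.card_pos.mp (by have := hPcard u hu.2; omega)
      obtain ⟨a, ha, hmin⟩ := Finset.exists_min_image (P u) (fun b => (D u b).card) hne
      exact ⟨a, fun _ _ => ⟨ha, hmin⟩⟩
    · exact ⟨0, fun h1 h2 => absurd ⟨h1, h2⟩ hu⟩
  choose a₀ ha₀ using hrep
  obtain ⟨B, hB⟩ : ∃ B : ℕ → Finset ℕ, ∀ u, B u = D u (a₀ u) := ⟨_, fun _ => rfl⟩
  obtain ⟨δ, hδ⟩ : ∃ δ : ℕ → G, ∀ u, δ u = φ (a₀ u + u) - φ (a₀ u) := ⟨_, fun _ => rfl⟩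
  -- reading an unrecorded pair
  have read : ∀ u a, a ∈ S → a + u ∈ S → a ∉ B u → φ (a + u) - φ a = δ u := by
    intro u a ha hau hBa
    by_contra h
    apply hBa
    rw [hB, hD]
    refine Finset.mem_filter.mpr ⟨by rw [hP]; exact Finset.mem_filter.mpr ⟨ha, hau⟩, ?_⟩
    rw [hδ] at h
    exact fun h' => h h'.symm
  -- the fibrewise count of `V`
  have count : ∑ u ∈ Finset.Icc 1 Q, (P u).card * (B u).card ≤ V.card := by
    calc ∑ u ∈ Finset.Icc 1 Q, (P u).card * (B u).card
        ≤ ∑ u ∈ Finset.Icc 1 Q, (V.filter (fun p => p.2 = u)).card := by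
          refine Finset.sum_le_sum (fun u hu => ?_)
          rw [Finset.mem_Icc] at hu
          obtain ⟨_, hmin⟩ := ha₀ u hu.1 (by omega)
          calc (P u).card * (B u).card
              ≤ ∑ a ∈ P u, (D u a).card := by
                have h := Finset.card_nsmul_le_sum (P u) (fun a => (D u a).card) ((B u).card)
                  (fun b hb => by rw [hB]; exact hmin b hb)
                rw [smul_eq_mul] at h
                exact h
            _ ≤ ∑ a ∈ P u,
                  ((V.filter (fun p => p.2 = u)).filter (fun p => p.1.1 = a)).card := by
                refine Finset.sum_le_sum (fun a ha => ?_)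
                obtain ⟨haS, hauS⟩ := memP u a ha
                refine Finset.card_le_card_of_injOn (fun b => ((a, b), u)) (fun b hb => ?_) ?_
                · have hb₀ : b ∈ D u a := Finset.mem_coe.mp hb
                  rw [hD, Finset.mem_filter] at hb₀
                  obtain ⟨hbS, hbuS⟩ := memP u b hb₀.1
                  refine Finset.mem_coe.mpr
                    (Finset.mem_filter.mpr ⟨Finset.mem_filter.mpr ⟨?_, rfl⟩, rfl⟩)
                  exact hV a haS b hbS u hauS hbuS hb₀.2
                · intro b _ b' _ h
                  simpa using h
            _ = ((V.filter (fun p => p.2 = u)).filter (fun p => p.1.1 ∈ P u)).card :=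
                Finset.sum_card_fiberwise_eq_card_filter _ _ _
            _ ≤ (V.filter (fun p => p.2 = u)).card := Finset.card_le_card (Finset.filter_subset _ _)
      _ = (V.filter (fun p => p.2 ∈ Finset.Icc 1 Q)).card :=
          Finset.sum_card_fiberwise_eq_card_filter _ _ _
      _ ≤ V.card := Finset.card_le_card (Finset.filter_subset _ _)
  -- good and non-good differences
  obtain ⟨Good, hGdef⟩ : ∃ Good : Finset ℕ,
      Good = (Finset.Icc 1 Q).filter (fun u => 20 * (B u).card ≤ K) := ⟨_, rfl⟩
  obtain ⟨NG, hNGdef⟩ : ∃ NG : Finset ℕ,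
      NG = (Finset.Icc 1 Q).filter (fun u => ¬ 20 * (B u).card ≤ K) := ⟨_, rfl⟩
  have hNGeq : Finset.Icc 1 Q \ Good = NG := by rw [hNGdef, hGdef, Finset.filter_not]
  have memGood : ∀ u ∈ Good, 1 ≤ u ∧ u ≤ Q ∧ 20 * (B u).card ≤ K := by
    intro u hu
    rw [hGdef, Finset.mem_filter, Finset.mem_Icc] at hu
    exact ⟨hu.1.1, hu.1.2, hu.2⟩
  have hsplit : ∑ u ∈ NG, (P u).card * (B u).card + ∑ u ∈ Good, (P u).card * (B u).card
      = ∑ u ∈ Finset.Icc 1 Q, (P u).card * (B u).card := by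
    rw [hNGdef, hGdef]
    exact Finset.sum_filter_not_add_sum_filter _ _ _
  -- `NG` is small
  have hNGsum : NG.card * (73 * K * K) ≤ 2000 * V.card := by
    have h1 : NG.card * (73 * K * K) ≤ ∑ u ∈ NG, 2000 * ((P u).card * (B u).card) := by
      have h := Finset.card_nsmul_le_sum NG (fun u => 2000 * ((P u).card * (B u).card))
        (73 * K * K) (fun u hu => by
          rw [hNGdef, Finset.mem_filter, Finset.mem_Icc] at hu
          have hp := hP73 u hu.1.2
          have hb : K ≤ 20 * (B u).card := by omega
          calc 73 * K * K ≤ (100 * (P u).card) * (20 * (B u).card) := Nat.mul_le_mul hp hb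
            _ = 2000 * ((P u).card * (B u).card) := by ring)
      rw [smul_eq_mul] at h
      exact h
    rw [← Finset.mul_sum] at h1
    have h2 : ∑ u ∈ NG, (P u).card * (B u).card ≤ V.card := by
      have := hsplit
      have := count
      omega
    exact h1.trans (Nat.mul_le_mul_left _ h2)
  have hNGlin : 365 * NG.card ≤ K := by
    have h : K * K * (365 * NG.card) ≤ K * K * K := by
      calc K * K * (365 * NG.card) = 5 * (NG.card * (73 * K * K)) := by ring
        _ ≤ 5 * (2000 * V.card) := Nat.mul_le_mul_left _ hNGsum
        _ = 10000 * V.card := by ring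
        _ ≤ K ^ 3 := hVK
        _ = K * K * K := by ring
    exact Nat.le_of_mul_le_mul_left h (Nat.mul_pos (by omega) (by omega))
  -- the recorded edges `W = ∑_{u good} #(B u)` are few
  obtain ⟨W, hWdef⟩ : ∃ W : ℕ, W = ∑ u ∈ Good, (B u).card := ⟨_, rfl⟩
  have hW73 : 73 * K * W ≤ 100 * V.card := by
    have h1 : ∑ u ∈ Good, 73 * K * (B u).card
        ≤ ∑ u ∈ Good, 100 * ((P u).card * (B u).card) := by
      refine Finset.sum_le_sum (fun u hu => ?_)
      obtain ⟨_, huQ, _⟩ := memGood u hu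
      calc 73 * K * (B u).card ≤ (100 * (P u).card) * (B u).card :=
            Nat.mul_le_mul_right _ (hP73 u huQ)
        _ = 100 * ((P u).card * (B u).card) := by ring
    rw [← Finset.mul_sum, ← Finset.mul_sum] at h1
    have h2 : ∑ u ∈ Good, (P u).card * (B u).card ≤ V.card := by
      have := hsplit
      have := count
      omega
    rw [hWdef]
    exact h1.trans (Nat.mul_le_mul_left _ h2)
  have hWlin : 7300 * W ≤ K * K := by
    have h : K * (7300 * W) ≤ K * (K * K) := by
      calc K * (7300 * W) = 100 * (73 * K * W) := by ring
        _ ≤ 100 * (100 * V.card) := Nat.mul_le_mul_left _ hW73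
        _ = 10000 * V.card := by ring
        _ ≤ K ^ 3 := hVK
        _ = K * (K * K) := by ring
    exact Nat.le_of_mul_le_mul_left h (by omega)
  -- good differences add (a base point by pigeonhole against six small sets)
  have card6 : ∀ X₁ X₂ X₃ X₄ X₅ X₆ : Finset ℕ, (X₁ ∪ X₂ ∪ X₃ ∪ X₄ ∪ X₅ ∪ X₆).card
      ≤ X₁.card + X₂.card + X₃.card + X₄.card + X₅.card + X₆.card := by
    intro X₁ X₂ X₃ X₄ X₅ X₆
    have h5 := Finset.card_union_le (X₁ ∪ X₂ ∪ X₃ ∪ X₄ ∪ X₅) X₆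
    have h4 := Finset.card_union_le (X₁ ∪ X₂ ∪ X₃ ∪ X₄) X₅
    have h3 := Finset.card_union_le (X₁ ∪ X₂ ∪ X₃) X₄
    have h2 := Finset.card_union_le (X₁ ∪ X₂) X₃
    have h1 := Finset.card_union_le X₁ X₂
    omega
  have δadd : ∀ u ∈ Good, ∀ v ∈ Good, u + v ∈ Good → δ (u + v) = δ u + δ v := by
    intro u hu v hv huv
    obtain ⟨_, _, huB⟩ := memGood u hu
    obtain ⟨_, _, hvB⟩ := memGood v hv
    obtain ⟨_, huvQ, huvB⟩ := memGood (u + v) huv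
    have hcard : (E ∪ E.image (fun x => x - u) ∪ E.image (fun x => x - (u + v)) ∪ B u
        ∪ (B v).image (fun x => x - u) ∪ B (u + v)).card < (Finset.Icc 1 (K - (u + v))).card := by
      refine (card6 _ _ _ _ _ _).trans_lt ?_
      have i1 : (E.image (fun x => x - u)).card ≤ E.card := Finset.card_image_le
      have i2 : (E.image (fun x => x - (u + v))).card ≤ E.card := Finset.card_image_le
      have i3 : ((B v).image (fun x => x - u)).card ≤ (B v).card := Finset.card_image_le
      rw [Nat.card_Icc]; omega
    obtain ⟨s, hsI, hsB⟩ := Finset.exists_mem_notMem_of_card_lt_card hcard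
    rw [Finset.mem_Icc] at hsI
    simp only [Finset.mem_union, not_or] at hsB
    obtain ⟨⟨⟨⟨⟨hs1, hs2⟩, hs3⟩, hs4⟩, hs5⟩, hs6⟩ := hsB
    have sS : s ∈ S := memS s (by omega) (by omega) hs1
    have suS : s + u ∈ S := memS (s + u) (by omega) (by omega)
      (fun h => hs2 (Finset.mem_image.mpr ⟨s + u, h, Nat.add_sub_cancel s u⟩))
    have suvS : s + (u + v) ∈ S := memS (s + (u + v)) (by omega) (by omega)
      (fun h => hs3 (Finset.mem_image.mpr ⟨s + (u + v), h, Nat.add_sub_cancel s (u + v)⟩))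
    have h4 : s + u + v = s + (u + v) := add_assoc _ _ _
    have e1 : φ (s + u) - φ s = δ u := read u s sS suS hs4
    have e2 : φ (s + u + v) - φ (s + u) = δ v := read v (s + u) suS (by rw [h4]; exact suvS)
      (fun h => hs5 (Finset.mem_image.mpr ⟨s + u, h, Nat.add_sub_cancel s u⟩))
    have e3 : φ (s + (u + v)) - φ s = δ (u + v) := read (u + v) s sS suvS hs6
    rw [h4] at e2
    rw [← e1, ← e2, ← e3]
    abel
  -- Lemma L on the good differences: the slope `μ`
  have hGsub : Good ⊆ Finset.Icc 1 Q := by rw [hGdef]; exact Finset.filter_subset _ _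
  have hQ200 : 200 ≤ Q := by omega
  have hNG50 : 50 * (Finset.Icc 1 Q \ Good).card ≤ Q := by rw [hNGeq]; omega
  obtain ⟨μ, hμ⟩ := soloAR_additive_on_dense_interval_eq_nsmul hQ200 hGsub hNG50 δ δadd
  -- unrecorded good pairs are equal edges for `c s = φ s - s • μ`
  have hF1 : ∀ u ∈ Good, ∀ a ∈ S, a + u ∈ S → a ∉ B u →
      φ (a + u) - (a + u) • μ = φ a - a • μ := by
    intro u hu a ha hau hBa
    have h := read u a ha hau hBa
    rw [hμ u hu] at h
    rw [add_nsmul]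
    calc φ (a + u) - (a • μ + u • μ) = (φ (a + u) - φ a) - u • μ + (φ a - a • μ) := by abel
      _ = φ a - a • μ := by rw [h]; abel
  -- Lemma T: `c` is constant off a sparse set
  have hNG100 : 100 * (Finset.Icc 1 (K / 4) \ Good).card ≤ K := by rw [← hQ, hNGeq]; omega
  have hW4000 : 4000 * ∑ u ∈ Good, (B u).card ≤ K * K := by rw [← hWdef]; omega
  obtain ⟨c₀, X, hX, hcX⟩ :=
    soloAV_eq_const_off_sparse hK hS hE hNG100 B hW4000 (fun s => φ s - s • μ) hF1
  refine ⟨c₀, μ, X, ?_, fun s hs hsX => ?_⟩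
  · have h1 : X.card * (K / 40 + 1) ≤ 2 * W := by rw [hWdef]; exact hX
    have h2 : K ≤ 40 * (K / 40 + 1) := by omega
    have h3 : 73 * (K ^ 2 * X.card) ≤ 8000 * V.card := by
      calc 73 * (K ^ 2 * X.card) = 73 * K * (X.card * K) := by ring
        _ ≤ 73 * K * (X.card * (40 * (K / 40 + 1))) :=
            Nat.mul_le_mul_left _ (Nat.mul_le_mul_left _ h2)
        _ = 40 * (73 * K * (X.card * (K / 40 + 1))) := by ring
        _ ≤ 40 * (73 * K * (2 * W)) := Nat.mul_le_mul_left _ (Nat.mul_le_mul_left _ h1)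
        _ = 80 * (73 * K * W) := by ring
        _ ≤ 80 * (100 * V.card) := Nat.mul_le_mul_left _ hW73
        _ = 8000 * V.card := by ring
    omega
  · have h : φ s - s • μ = c₀ := hcX s hs hsX
    rw [← h, sub_add_cancel]

end Summit.Schanuel.Schanuel.Theorems
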